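import Literature.Analysis.FluidPDE.NSLerayRegularisedExistenceProofs
import Literature.Analysis.FluidPDE.NSLerayRegularisedLimitHolds
import HarnessLib

/-!
# Leray 1934, Théorème d'existence on `ℝ³` (`leray_existence_R3`) — discharged

Analysis/FluidPDE glue file **discharging the named fact
`Literature.Analysis.FluidPDE.leray_existence_R3`** (`NSLerayHopf.lean`, ns.S06; J. Leray,
*Sur le mouvement d'un liquide visqueux emplissant l'espace*, Acta Math. 63 (1934), Ch. V §31,
p. 241, *Théorème d'existence*: every square-summable datum of quasi-divergence zero admits at
least one *solution turbulente* defined for all later times; modern statements Ożański–Pooley 2018,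
Thm. 6.37 with Def. 6.35 and Cor. 6.36, and Robinson–Rodrigo–Sadowski 2016, Thm. 14.4).

The accepted tree reduction follows Leray's own proof (Ch. V, §§26–31):
`leray_existence_R3_of_wellposed_of_limit : leray_regularised_wellposed → leray_regularised_limit →
leray_existence_R3` (`NSLerayRegularisedExistence.lean`: the regularised scheme exists once the
regularised problem is globally well posed with the `ε`-uniform separation of energy, and its limit
is a global Leray–Hopf weak solution). Both hypotheses are discharged in the tree:
`leray_regularised_wellposed_holds` (`NSLerayRegularisedExistenceProofs.lean`, Leray §§26–27;
OP 2018 Thm. 6.33, Lemma 6.34) and `leray_regularised_limit_holds`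
(`NSLerayRegularisedLimitHolds.lean`, Leray §§28–31; OP 2018 Thm. 6.37). Hence
`leray_existence_R3_holds`, the composition announced in the docstring of `leray_existence_R3`.

Theorem-only glue module: no definitions, no named facts, no `sorry`; the theorem is a
composition of an accepted tree reduction with accepted discharges (pure proof of an unchanged
statement).

## Mathlib / tree search

`leray_existence_R3_holds` / `: leray_existence_R3 :=`: no prior discharge in `Literature/` or
`Summits/` (2026-08-15T08:30Z); the three ingredients are at
`NSLerayRegularisedExistence.lean:134`, `NSLerayRegularisedExistenceProofs.lean:61`,
`NSLerayRegularisedLimitHolds.lean:1389`.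

## References

* J. Leray, *Sur le mouvement d'un liquide visqueux emplissant l'espace*, Acta Math. 63 (1934),
  193–248, Ch. V §§26–31, Théorème d'existence p. 241. [Leray1934]
* W. S. Ożański, B. C. Pooley, *Leray's fundamental work on the Navier–Stokes equations: a modern
  review of "Sur le mouvement d'un liquide visqueux emplissant l'espace"*, LMS Lecture Note Ser.
  452 (CUP 2018) = arXiv:1708.09787, Def. 6.35, Cor. 6.36, Thm. 6.37. [OzanskiPooley2018]
* J. C. Robinson, J. L. Rodrigo, W. Sadowski, *The Three-Dimensional Navier–Stokes Equations*,
  CUP (2016), Thm. 14.4. [RobinsonRodrigoSadowski2016]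
-/

noncomputable section

namespace Literature.Analysis.FluidPDE

/-- **Leray's existence theorem on `ℝ³` (ns.S06), proved** (the named statement
`leray_existence_R3`: for every `ν > 0` and every weakly divergence-free `u₀ ∈ L²(ℝ³)` there is a
global Leray–Hopf weak solution of the unforced Navier–Stokes system with datum `u₀`), by
`leray_existence_R3_of_wellposed_of_limit` applied to `leray_regularised_wellposed_holds` and
`leray_regularised_limit_holds`. [cite: Leray1934, Ch. V §31, p. 241, Théorème d'existence] -/
theorem leray_existence_R3_holds : leray_existence_R3 :=
  leray_existence_R3_of_wellposed_of_limit leray_regularised_wellposed_holds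
    leray_regularised_limit_holds

end Literature.Analysis.FluidPDE
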